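import Summits.HodgeConjecture.HodgeConjecture.Theorems.R90S4EpsCentralizerMeasureTransport   -- ★ p862879 (this seat) B3-2: `haar_map_eq_of_apply_compactCore_eq_one`, `isInvInvariant_map_of_continuousMulEquiv`; brings ★ `R90S4EpsOrbitalCanonical` (`IsEpsCanonicalAt`, `isClosed_epsCentralizer`), ★ `R90S4EpsRegularTransport`-free C-TT `R90S4TwistedTransferDefs` (`IsEpsRegularAt`, `IsStablyEpsConjAt`), ★ `R90S4TwistedNormMap{,Local}` (`map_conj_epsCentralizer`, `isConj_epsNorm_of_isEpsConj`, `twistLocal_twistLocal_cm`), ★ Lit `OrbitalMeasureCanonicalAtPoint` ∕ `InvariantQuotientTransport` (`cosetCongr`, `subgroupCongrHomeomorph`, `map_cosetCongr_quotientMeasure`)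
import Summits.HodgeConjecture.HodgeConjecture.Theorems.R90S4EpsRegularTransport            -- ★ (K2E3-p17 g9): `isEpsRegularAt_iff_of_isStablyEpsConjAt`
import Literature.NumberTheory.Automorphic.CompactCoreLevelPoint                             -- ★ `map_mulAutConj_eq_self` (a bi-invariant measure is `Ad`-invariant)
import HarnessLib

/-!
# R90-TF · S4 «Ch. 13.1–2», (1D-CT) ∕ T-WIF road — AN ε-CANONICAL TWISTED ORBITAL FAMILY READ AT ANY ε-REPRESENTATIVE:
# `Φ_ε(⟦δ⟧, φ) = ∫_{G̃_v ⧸ G̃_{δε}} φ(y δ ε(y)⁻¹) d(νGt ∕ t)` for every member `δ` of the class and every core-normalised Haar `t` on `G̃_{δε}`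
# (Rogawski 1990, §4.10 (4.10.1) p. 57; §4.3 (4.3.1) p. 43; §12.5 p. 186)

Cell `hodgecm-mathlib`, crux H413 (`stmt-HodgeConjecture-24833`, lane `--supports … --as helper`), route of record `HCCMUnconditional` (no route verbs;
count-neutral).  Programme R90-TF, section S4 = [Rogawski1990] Ch. 13.1–13.2; seat R90-C131-p03 (g2), take-by-default (S4 dealer seat empty; `R90/STATUS.md`)
on the B3 ∕ (1D-CT) lineage: the ε-twisted twin of ★ `Literature/NumberTheory/Automorphic/OrbitalMeasureCanonicalAtPoint` («a canonical family read at any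
representative»), which the payer of B1 «T-WIF» (`IsTwistedWeylMeasure`, ★ `R90S4OneDimCharTransferOfWeylPair`) needs in order to integrate `Φ_ε(δ, φ)` over
`δ ∈ T̃` rather than over the chosen representatives `out c`.  THEOREMS ONLY — no `def`, no instance, no notation, no named-fact hypothesis, no `sorry`;
★-only imports (two S4 `Theorems` files), never `Lines`.

HONEST LABEL: HC_CM is proved only modulo the 7 printed citations (2 remaining named inputs: hLiu418 = stmt-HodgeConjecture-24832, h413 =
stmt-HodgeConjecture-24833) until rung 0 closes.  Measure-theoretic plumbing; discharges no socket by itself (REL ≠ ★ ≠ BUILT).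

## The mathematics

The tree's twisted orbital integral `Φ_ε(δ, φ) = ∫_{G̃ ⧸ G̃_{δε}} φ(y δ ε(y)⁻¹) dm(y)` (★ `Ch4Sec10.epsOrbitalIntegral`) enters (4.10.1) ∕ (4.10.2) through the CLASS function
★ `classEpsOrbitalIntegral mGt φ c = Φ_ε(out c, φ; mGt c)`, read at the chosen representative `out c` of the ε-class `c` against the member `mGt c`, and ★
`IsEpsCanonicalAt L Φ v νGt mGt` pins `mGt c = dνGt ∕ dt_c` for THE inversion-invariant Haar measure `t_c` on `G̃_{out c, ε}` with mass one on the compact core.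
For another member `δ = y · out c · ε(y)⁻¹` of an ε-regular class: `Ad(y)` carries `G̃_{out c, ε}` onto `G̃_{δε}` (★ `map_conj_epsCentralizer`), the induced map of
coset spaces carries `dνGt ∕ dt_c` to `dνGt ∕ d(Ad(y)_* t_c)` (naturality of the invariant quotient measure, ★ `map_cosetCongr_quotientMeasure`; a Haar measure on
the unimodular `G̃_v` is `Ad(y)`-invariant), `Ad(y)_* t_c` is Haar with mass one on the (intrinsic) compact core, hence IS any prescribed such `t` (★ B3-2
`haar_map_eq_of_apply_compactCore_eq_one`), and the twisted orbital integrand at `δ` pulls back along `Ad(y)` to the `y`-TRANSLATE of the integrand at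
`out c` (`φ((y g y⁻¹) δ ε(y g y⁻¹)⁻¹) = φ((yg)·out c·ε(yg)⁻¹)`), which the invariant member does not see.

* §1 (generic group with an endomorphism `ε`) `isEpsConj_of_eqvGen_epsConjModRel_bot`, **`isEpsConj_out_mk`** (the chosen representative of `⟦δ⟧_ε` is
  ε-conjugate to `δ`), `forall_conj_mem_epsCentralizer_iff` (`Ad(y) G̃_{δε} = G̃_{yδε(y)⁻¹,ε}`, membership form), **`descEpsConj_mk`** (the descended integrand on a
  coset `g G̃_{δε}` IS `φ(g δ ε(g)⁻¹)`), **`descEpsConj_cosetCongr_conj_apply`** (pull-back along `Ad(y)` = translate by `y`).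
* §2 (topological group, invariant measure on `G̃ ⧸ G̃_{δε}`) **`epsOrbitalIntegral_map_cosetCongr_conj`** — `Φ_ε(yδε(y)⁻¹, φ; Ad(y)_* m) = Φ_ε(δ, φ; m)` for every
  `G̃`-invariant `m` and every Banach-valued `φ` (exact transport, no integrability hypothesis); `Ad(y)_* νGt = νGt` is ★ `map_mulAutConj_eq_self`.
* §3 (the S4 carriers) **`IsEpsCanonicalAt.map_cosetCongr_conj_eq_quotientMeasure`** — for `mGt` ε-canonical, `out c` ε-regular, `y · out c · ε(y)⁻¹ = δ` and ANY
  inversion-invariant Haar `t` on `G̃_{δε}` with `t(compactCore) = 1`: `Ad(y)_* (mGt c) = dνGt ∕ dt`; hence **`IsEpsCanonicalAt.classEpsOrbitalIntegral_eq_epsOrbitalIntegral`**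
  — `classEpsOrbitalIntegral mGt φ c = Φ_ε(δ, φ; dνGt ∕ dt)`; and the `⟦δ⟧`-forms `…_mk` (hypotheses at `δ`: `δ` ε-regular, hermitian `Φ` — ε-regularity is an
  ε-class function, ★ `isEpsRegularAt_iff_of_isStablyEpsConjAt` + ★ `isConj_epsNorm_of_isEpsConj`).

[cite: Rogawski1990, §4.10 (4.10.1) p. 57; §4.3 (4.3.1) p. 43; §1.4 p. 4; §12.5 p. 186] [cite: DeitmarEchterhoff2014, Thm. 1.5.3]
-/

set_option autoImplicit false
-- the mandated namespace repeats the single-problem summit's segment (`HodgeConjecture.HodgeConjecture`)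
set_option linter.dupNamespace false

noncomputable section

open MeasureTheory Measure Topology
open scoped NumberField Matrix MatrixGroups ENNReal

namespace Summit.HodgeConjecture.HodgeConjecture.R90.S4

open Literature.NumberTheory.Rogawski1990 Literature.NumberTheory.Rogawski1990.Ch4Sec10
open Literature.NumberTheory.Automorphic Literature.MeasureTheory.Group
open IsDedekindDomain NumberField

/-! ## §1 Generic: representatives of ε-classes, conjugate ε-centralisers, the descended integrand -/

section Generic

variable {G : Type*} [Group G] (ε : G →* G)

/-- The equivalence relation generated by «ε-conjugate, or a `⊥`-translate» is ε-conjugacy (which is already an equivalence relation, ★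
`equivalence_isEpsConj`, and contains the generator). [cite: Rogawski1990, §1.4 p. 4; §3.11 p. 35] -/
theorem isEpsConj_of_eqvGen_epsConjModRel_bot {δ δ' : G} (h : Relation.EqvGen (epsConjModRel ε ⊥) δ δ') : IsEpsConj ε δ δ' := by
  have hrp : epsConjModRel ε ⊥ ≤ IsEpsConj ε := by
    intro a b hab
    rcases hab with hab | ⟨z, hz, hzab⟩
    · exact hab
    · rw [Subgroup.mem_bot] at hz
      rw [← hzab, hz, one_mul]
      exact isEpsConj_refl ε a
  exact (equivalence_isEpsConj ε).eqvGen_iff.1 (Relation.EqvGen.mono hrp δ δ' h)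

/-- **The chosen representative of the ε-class of `δ` is ε-conjugate to `δ`.** [cite: Rogawski1990, §1.4 p. 4] -/
theorem isEpsConj_out_mk (δ : G) :
    IsEpsConj ε (Quotient.out (Quotient.mk (Relation.EqvGen.setoid (epsConjModRel ε ⊥)) δ : EpsConjClassesMod ε ⊥)) δ := by
  have h := Quotient.exact (Quotient.out_eq (Quotient.mk (Relation.EqvGen.setoid (epsConjModRel ε ⊥)) δ))
  exact isEpsConj_of_eqvGen_epsConjModRel_bot ε h

/-- **`Ad(y)` carries `G̃_{δε}` onto `G̃_{δ′ε}`, `δ′ = y δ ε(y)⁻¹`** (membership form of ★ `map_conj_epsCentralizer`; the compatibility hypothesis of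
★ `cosetCongr (MulAut.conj y)`). [cite: Rogawski1990, §1.4 p. 4; §4.10 p. 57] -/
theorem forall_conj_mem_epsCentralizer_iff (y δ : G) :
    ∀ g : G, (MulAut.conj y : G ≃* G) g ∈ epsCentralizer ε (y * δ * (ε y)⁻¹) ↔ g ∈ epsCentralizer ε δ := fun g => by
  rw [← map_conj_epsCentralizer ε y δ, Subgroup.mem_map_equiv, MulEquiv.symm_apply_apply]

/-- **The descended twisted integrand on a coset**: for `M ≤ G̃_{δε}`, `descEpsConj ε δ M φ (g M) = φ(g δ ε(g)⁻¹)` (the representative `out (gM) = g m` with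
`m ∈ M` fixes `δ` under twisted conjugation). [cite: Rogawski1990, §1.6 p. 5; §4.10 (4.10.1) p. 57] -/
theorem descEpsConj_mk {δ : G} {M : Subgroup G} (hM : M ≤ epsCentralizer ε δ) {α : Type*} (φ : G → α) (g : G) :
    descEpsConj ε δ M φ (QuotientGroup.mk g : G ⧸ M) = φ (g * δ * (ε g)⁻¹) := by
  obtain ⟨m, hm⟩ := QuotientGroup.mk_out_eq_mul M g
  have hmδ : (m : G) * δ * (ε (m : G))⁻¹ = δ := (mem_epsCentralizer_iff ε δ _).1 (hM m.2)
  unfold descEpsConj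
  rw [hm, map_mul]
  congr 1
  calc g * (m : G) * δ * (ε g * ε (m : G))⁻¹ = g * ((m : G) * δ * (ε (m : G))⁻¹) * (ε g)⁻¹ := by group
    _ = g * δ * (ε g)⁻¹ := by rw [hmδ]

/-- **The twisted integrand at `δ′ = y δ ε(y)⁻¹` pulls back along `Ad(y)` to the `y`-translate of the twisted integrand at `δ`**:
`φ((ygy⁻¹) δ′ ε(ygy⁻¹)⁻¹) = φ((yg) δ ε(yg)⁻¹)`. [cite: Rogawski1990, §4.10 p. 57] -/
theorem descEpsConj_cosetCongr_conj_apply (y δ : G) {α : Type*} (φ : G → α) (x : G ⧸ epsCentralizer ε δ) :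
    descEpsConj ε (y * δ * (ε y)⁻¹) (epsCentralizer ε (y * δ * (ε y)⁻¹)) φ
        (cosetCongr (MulAut.conj y : G ≃* G) _ _ (forall_conj_mem_epsCentralizer_iff ε y δ) x) =
      descEpsConj ε δ (epsCentralizer ε δ) φ (y • x) := by
  induction x using QuotientGroup.induction_on with
  | H g =>
    rw [cosetCongr_mk, MulAction.Quotient.smul_mk, smul_eq_mul, descEpsConj_mk ε le_rfl, descEpsConj_mk ε le_rfl, MulAut.conj_apply, map_mul,
      map_mul, map_inv]
    congr 1
    group

end Generic

/-! ## §2 Invariant measures: the twisted orbital integral is blind to the representative -/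

section Invariant

variable {G : Type*} [Group G] [TopologicalSpace G] [IsTopologicalGroup G] [MeasurableSpace G] [BorelSpace G] (ε : G →* G)
  [∀ δ : G, MeasurableSpace (G ⧸ epsCentralizer ε δ)] [∀ δ : G, BorelSpace (G ⧸ epsCentralizer ε δ)]

/-- **`Φ_ε(y δ ε(y)⁻¹, φ; Ad(y)_* m) = Φ_ε(δ, φ; m)`** for every `G̃`-invariant measure `m` on `G̃ ⧸ G̃_{δε}` and every Banach-valued `φ`: change of variables along the
measurable equivalence `cosetCongr (Ad y)` (§1 `descEpsConj_cosetCongr_conj_apply`) and invariance of `m` under the translate by `y` (Mathlib `integral_smul_eq_self`).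
No integrability hypothesis (both sides are `0` together when the integrand is not integrable). [cite: Rogawski1990, §4.10 (4.10.1) p. 57; §4.3 p. 43] -/
theorem epsOrbitalIntegral_map_cosetCongr_conj (y δ : G) (m : Measure (G ⧸ epsCentralizer ε δ)) [SMulInvariantMeasure G (G ⧸ epsCentralizer ε δ) m]
    {E : Type*} [NormedAddCommGroup E] [NormedSpace ℝ E] (φ : G → E) :
    epsOrbitalIntegral ε (y * δ * (ε y)⁻¹) φ
        (m.map (cosetCongr (MulAut.conj y : G ≃* G) _ _ (forall_conj_mem_epsCentralizer_iff ε y δ))) =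
      epsOrbitalIntegral ε δ φ m := by
  have he : Continuous (MulAut.conj y : G ≃* G) := IsTopologicalGroup.continuous_conj y
  have hes : Continuous (MulAut.conj y : G ≃* G).symm := by
    change Continuous fun h => y⁻¹ * h * y
    exact (continuous_mul_const y).comp (continuous_const_mul y⁻¹)
  unfold epsOrbitalIntegral
  rw [← coe_cosetCongrHomeomorph (MulAut.conj y : G ≃* G) _ _ _ he hes, ← Homeomorph.toMeasurableEquiv_coe, integral_map_equiv]
  simp only [Homeomorph.toMeasurableEquiv_coe, coe_cosetCongrHomeomorph]
  simp_rw [descEpsConj_cosetCongr_conj_apply ε y δ φ]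
  exact integral_smul_eq_self _

end Invariant

/-! ## §3 The S4 carriers: an ε-canonical family read at any member of an ε-regular class -/

section EpsCanonical

variable {L : Type} [Field L] [NumberField L] [IsCMField L] {Φ : GL (Fin 3) L}
  {v : HeightOneSpectrum (𝓞 ↥(maximalRealSubfield L))}
  [LocallyCompactSpace (GtLoc L v)] [SecondCountableTopology (GtLoc L v)] [T2Space (GtLoc L v)]
  [MeasurableSpace (GtLoc L v)] [BorelSpace (GtLoc L v)]
  [∀ δ : GtLoc L v, MeasurableSpace (GtLoc L v ⧸ epsCentralizer (epsLoc L Φ v) δ)]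
  [∀ δ : GtLoc L v, BorelSpace (GtLoc L v ⧸ epsCentralizer (epsLoc L Φ v) δ)]
  {νGt : Measure (GtLoc L v)} [νGt.IsHaarMeasure] [νGt.IsMulRightInvariant]
  {mGt : EpsOrbitalMeasureFamily (epsLoc L Φ v) ⊥}

/-- **AN ε-CANONICAL MEMBER TRANSPORTED TO ANY REPRESENTATIVE IS `dνGt ∕ dt`**: for `mGt` ε-canonical for `νGt` (★ `IsEpsCanonicalAt`), an ε-class `c` with `out c`
ε-regular, `y` with `y · out c · ε(y)⁻¹ = δ`, and ANY inversion-invariant Haar measure `t` on `G̃_{δε}` with `t(compactCore) = 1`, the push-forward of `mGt c` along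
`cosetCongr (Ad y) : G̃_v ⧸ G̃_{out c,ε} ≃ G̃_v ⧸ G̃_{δε}` is `quotientMeasure G̃_{δε} t _ νGt` (★ `map_cosetCongr_quotientMeasure` with `Ad(y)_* νGt = νGt`; the transported
normalising measure is Haar with mass one on the compact core, hence equals `t`, ★ `haar_map_eq_of_apply_compactCore_eq_one`).
[cite: Rogawski1990, §4.3 (4.3.1) p. 43; §4.10 (4.10.1) p. 57] [cite: DeitmarEchterhoff2014, Thm. 1.5.3] -/
theorem IsEpsCanonicalAt.map_cosetCongr_conj_eq_quotientMeasure (hcan : IsEpsCanonicalAt L Φ v νGt mGt)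
    (c : EpsConjClassesMod (epsLoc L Φ v) ⊥) (hc : IsEpsRegularAt L Φ v (Quotient.out c))
    {y δ : GtLoc L v} (hy : y * Quotient.out c * (epsLoc L Φ v y)⁻¹ = δ)
    (t : Measure ↥(epsCentralizer (epsLoc L Φ v) δ)) [t.IsHaarMeasure] [t.IsInvInvariant]
    (ht : t (compactCore ↥(epsCentralizer (epsLoc L Φ v) δ)) = 1) :
    Measure.map (cosetCongr (MulAut.conj y : GtLoc L v ≃* GtLoc L v) _ (epsCentralizer (epsLoc L Φ v) δ)
        (fun g => by rw [← hy]; exact forall_conj_mem_epsCentralizer_iff (epsLoc L Φ v) y (Quotient.out c) g)) (mGt c) =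
      quotientMeasure (epsCentralizer (epsLoc L Φ v) δ) t (isClosed_epsCentralizer L Φ v δ) νGt := by
  obtain ⟨t₀, ht₀, hti₀, h1₀, hmc⟩ := hcan c hc
  have he : Continuous (MulAut.conj y : GtLoc L v ≃* GtLoc L v) := IsTopologicalGroup.continuous_conj y
  have hes : Continuous (MulAut.conj y : GtLoc L v ≃* GtLoc L v).symm := by
    change Continuous fun h => y⁻¹ * h * y
    exact (continuous_mul_const y).comp (continuous_const_mul y⁻¹)
  have hHH : ∀ g : GtLoc L v, (MulAut.conj y : GtLoc L v ≃* GtLoc L v) g ∈ epsCentralizer (epsLoc L Φ v) δ ↔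
      g ∈ epsCentralizer (epsLoc L Φ v) (Quotient.out c) := fun g => by
    rw [← hy]; exact forall_conj_mem_epsCentralizer_iff (epsLoc L Φ v) y (Quotient.out c) g
  haveI hZc : IsClosed ((epsCentralizer (epsLoc L Φ v) (Quotient.out c) : Subgroup (GtLoc L v)) : Set (GtLoc L v)) :=
    isClosed_epsCentralizer L Φ v _
  haveI hZ'c : IsClosed ((epsCentralizer (epsLoc L Φ v) δ : Subgroup (GtLoc L v)) : Set (GtLoc L v)) := isClosed_epsCentralizer L Φ v δ
  haveI : LocallyCompactSpace ↥(epsCentralizer (epsLoc L Φ v) δ) := hZ'c.isClosedEmbedding_subtypeVal.locallyCompactSpace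
  haveI : SecondCountableTopology ↥(epsCentralizer (epsLoc L Φ v) δ) := TopologicalSpace.Subtype.secondCountableTopology _
  -- `Ad(y)` restricted to the ε-centralisers, as a homeomorphism and as a `≃ₜ*`
  let eH : ↥(epsCentralizer (epsLoc L Φ v) (Quotient.out c)) ≃ₜ ↥(epsCentralizer (epsLoc L Φ v) δ) :=
    subgroupCongrHomeomorph (MulAut.conj y : GtLoc L v ≃* GtLoc L v) _ _ hHH he hes
  let eZ : ↥(epsCentralizer (epsLoc L Φ v) (Quotient.out c)) ≃ₜ* ↥(epsCentralizer (epsLoc L Φ v) δ) :=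
    { toMulEquiv :=
        { toEquiv := eH.toEquiv
          map_mul' := fun a b => Subtype.ext (map_mul (MulAut.conj y : GtLoc L v ≃* GtLoc L v) (a : GtLoc L v) (b : GtLoc L v)) }
      continuous_toFun := eH.continuous
      continuous_invFun := eH.symm.continuous }
  have heZ : (eZ : _ → ↥(epsCentralizer (epsLoc L Φ v) δ)) = eH := rfl
  have hmap : Measure.map eH t₀ = t := by
    rw [← heZ]
    exact haar_map_eq_of_apply_compactCore_eq_one eZ t₀ t h1₀ ht
  rw [hmc]
  exact map_cosetCongr_quotientMeasure (MulAut.conj y : GtLoc L v ≃* GtLoc L v) he hes _ _ hHH t₀ t νGt νGt hmap.symm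
    (map_mulAutConj_eq_self νGt y).symm

/-- **AN ε-CANONICAL FAMILY READ AT ANY REPRESENTATIVE (the T-WIF head)**: for `mGt` ε-canonical for `νGt`, an ε-class `c` with `out c` ε-regular, a member
`δ = y · out c · ε(y)⁻¹` of `c`, ANY inversion-invariant Haar measure `t` on `G̃_{δε}` with `t(compactCore) = 1`, and every Banach-valued `φ : G̃_v → E`:
`classEpsOrbitalIntegral mGt φ c = Φ_ε(δ, φ; dνGt ∕ dt)` — the class twisted orbital integral (taken at `out c` against the pinned member) equals the twisted
orbital integral at `δ` against `dνGt ∕ dt` («the twisted orbital integrals are defined using compatible measures», §4.3, and do not depend on the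
representative).  Exact transport (§2) + `map_cosetCongr_conj_eq_quotientMeasure`; the pinned member is invariant (★ `smulInvariantMeasure_quotientMeasure`).
[cite: Rogawski1990, §4.10 (4.10.1) p. 57; §4.3 (4.3.1) p. 43; §12.5 p. 186] [cite: DeitmarEchterhoff2014, Thm. 1.5.3] -/
theorem IsEpsCanonicalAt.classEpsOrbitalIntegral_eq_epsOrbitalIntegral (hcan : IsEpsCanonicalAt L Φ v νGt mGt)
    (c : EpsConjClassesMod (epsLoc L Φ v) ⊥) (hc : IsEpsRegularAt L Φ v (Quotient.out c))
    {y δ : GtLoc L v} (hy : y * Quotient.out c * (epsLoc L Φ v y)⁻¹ = δ)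
    (t : Measure ↥(epsCentralizer (epsLoc L Φ v) δ)) [t.IsHaarMeasure] [t.IsInvInvariant]
    (ht : t (compactCore ↥(epsCentralizer (epsLoc L Φ v) δ)) = 1)
    {E : Type*} [NormedAddCommGroup E] [NormedSpace ℝ E] (φ : GtLoc L v → E) :
    classEpsOrbitalIntegral (epsLoc L Φ v) mGt φ c =
      epsOrbitalIntegral (epsLoc L Φ v) δ φ (quotientMeasure (epsCentralizer (epsLoc L Φ v) δ) t (isClosed_epsCentralizer L Φ v δ) νGt) := by
  obtain ⟨t₀, ht₀, hti₀, -, hmc⟩ := hcan c hc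
  haveI : SMulInvariantMeasure (GtLoc L v) (GtLoc L v ⧸ epsCentralizer (epsLoc L Φ v) (Quotient.out c)) (mGt c) := by
    rw [hmc]; exact smulInvariantMeasure_quotientMeasure _ _ _ _
  rw [← hcan.map_cosetCongr_conj_eq_quotientMeasure c hc hy t ht]
  subst hy
  unfold classEpsOrbitalIntegral
  exact (epsOrbitalIntegral_map_cosetCongr_conj (epsLoc L Φ v) y (Quotient.out c) (mGt c) φ).symm

/-- **The `⟦δ⟧`-form** (hermitian `Φ`, hypotheses at `δ`): for `mGt` ε-canonical, `δ` ε-regular, ANY inversion-invariant Haar `t` on `G̃_{δε}` with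
`t(compactCore) = 1`, and every `φ`: `classEpsOrbitalIntegral mGt φ ⟦δ⟧_ε = Φ_ε(δ, φ; dνGt ∕ dt)`.  (The representative `out ⟦δ⟧_ε` is ε-conjugate to `δ`, §1
`isEpsConj_out_mk`; ε-regularity is an ε-class function — the norms are conjugate, ★ `isConj_epsNorm_of_isEpsConj` with `ε_v ∘ ε_v = 1` ★ `twistLocal_twistLocal_cm`.)
[cite: Rogawski1990, §4.10 (4.10.1) p. 57; §4.3 (4.3.1) p. 43; §3.11 p. 34] -/
theorem IsEpsCanonicalAt.classEpsOrbitalIntegral_mk_eq_epsOrbitalIntegral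
    (hΦ : ((Φ : GL (Fin 3) L) : Matrix (Fin 3) (Fin 3) L)ᵀ.map (IsCMField.complexConj L) = (Φ : Matrix (Fin 3) (Fin 3) L))
    (hcan : IsEpsCanonicalAt L Φ v νGt mGt) {δ : GtLoc L v} (hδ : IsEpsRegularAt L Φ v δ)
    (t : Measure ↥(epsCentralizer (epsLoc L Φ v) δ)) [t.IsHaarMeasure] [t.IsInvInvariant]
    (ht : t (compactCore ↥(epsCentralizer (epsLoc L Φ v) δ)) = 1)
    {E : Type*} [NormedAddCommGroup E] [NormedSpace ℝ E] (φ : GtLoc L v → E) :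
    classEpsOrbitalIntegral (epsLoc L Φ v) mGt φ
        (Quotient.mk (Relation.EqvGen.setoid (epsConjModRel (epsLoc L Φ v) ⊥)) δ : EpsConjClassesMod (epsLoc L Φ v) ⊥) =
      epsOrbitalIntegral (epsLoc L Φ v) δ φ (quotientMeasure (epsCentralizer (epsLoc L Φ v) δ) t (isClosed_epsCentralizer L Φ v δ) νGt) := by
  obtain ⟨y, hy⟩ := isEpsConj_out_mk (epsLoc L Φ v) δ
  have hε : ∀ g : GtLoc L v, epsLoc L Φ v (epsLoc L Φ v g) = g := fun g => twistLocal_twistLocal_cm L 3 Φ hΦ v g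
  have hst : IsStablyEpsConjAt L Φ v
      (Quotient.out (Quotient.mk (Relation.EqvGen.setoid (epsConjModRel (epsLoc L Φ v) ⊥)) δ : EpsConjClassesMod (epsLoc L Φ v) ⊥)) δ :=
    isConj_epsNorm_of_isEpsConj hε ⟨y, hy⟩
  have hc : IsEpsRegularAt L Φ v
      (Quotient.out (Quotient.mk (Relation.EqvGen.setoid (epsConjModRel (epsLoc L Φ v) ⊥)) δ : EpsConjClassesMod (epsLoc L Φ v) ⊥)) :=
    (isEpsRegularAt_iff_of_isStablyEpsConjAt hst).2 hδ
  exact hcan.classEpsOrbitalIntegral_eq_epsOrbitalIntegral _ hc hy t ht φ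

end EpsCanonical

end Summit.HodgeConjecture.HodgeConjecture.R90.S4

end
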